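import Summits.ValiantsHypothesis.ValiantsHypothesis.Theorems.GeneratorObstructionsPerGenDegreeSuperQPBinaryRay
import Summits.ValiantsHypothesis.ValiantsHypothesis.Theorems.GeneratorObstructionsPerGenDegreeSuperQPChowRayAtom
import Literature.Computability.AlgebraicComplexity.BI17PowerSumDegreeProofs

/-!
# Route GeneratorObstructions — K1 `PerGenDegreeSuperQP` (stmt-ValiantsHypothesis-11654),
# line `per-side-atoms`: first degrees on the ray `j = 2` of `S(per_m)` — `(2m,2m)^*` occurs in
# degree `4` for every `m ≥ 2`, and for even `m` the first atom is `(m,m)^*` in degree `2`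

Twenty-first support file of the line; degrees on the binary ray, from BI 2017 Prop. 3.24 for the
power sum `y^m + w^m` (tree `BI2017_prop_3_24_part1`: `e = 2` for even `m`;
`two_mul_mem_degreeMonoid_psum`: `4 ∈ E` whenever `4 ≤ binom(2m, m)`) and the ray criterion:

* `per_rectangle_two_twoMul_occurs` — `(2m, 2m)^* ∈ S(per_m)` (degree `4`) for all `m ≥ 2`;
* `per_rectangle_two_self_occurs_of_even` — `(m, m)^* ∈ S(per_m)` (degree `2`) for even `m ≥ 2`;
* `per_rayTwo_atom_of_even` — for even `m ≥ 2` the first atom on the ray `2` is `(m,m)^*`, in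
  degree `2` (first parts are `≥ m`, `…ChowRayAtom.le_of_per_rectangle_occurs`).

So the ray `2` starts in degree `2` (even `m`) or `≤ 4` (odd `m`): EARLY, like every ray whose
first degree is pinned so far (Chow ray `m`: `m` or `m+1`; top ray: `e(per_m) ≥ m²`). Honest
framing: calibration data; `stub_atomLate` (`c ≥ 2`), K1 and `GenFlipThesis` remain OPEN; nothing
here bears on VP versus VNP. References: [BurgisserIkenmeyer2017] Prop. 3.24, Def. 3.3.
-/

set_option linter.dupNamespace false

noncomputable section

namespace Summit.ValiantsHypothesis.ValiantsHypothesis.Theorems.GeneratorObstructions.PerGenDegreeSuperQP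

open MvPolynomial
open Literature.NumberTheory.DiophantineGeometry Literature.Computability.AlgebraicComplexity
  Literature.Computability.Complexity

variable {m : ℕ}

/-- The binary Fermat form is the power sum on `Fin 2`. [folklore] -/
theorem binaryFermat_eq_psum (m : ℕ) :
    ((X 0) ^ m + (X 1) ^ m : MvPolynomial (Fin 2) ℂ) = ∑ i : Fin 2, (X i : MvPolynomial (Fin 2) ℂ) ^ m := by
  rw [Fin.sum_univ_two]

/-- From `d ∈ E(y^m + w^m)`: the rectangular weight `((m d / 2)^2)^*` occurs in `ℂ[Δ_m[per_m]]`
(ray criterion on the binary degeneration of `…BinaryRay`). [cite: BurgisserIkenmeyer2017, Def. 3.3] -/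
theorem per_rectangle_two_occurs_of_mem_degreeMonoid (hm : 2 ≤ m) {d : ℕ}
    (hd : d ∈ degreeMonoid m ((X 0) ^ m + (X 1) ^ m : MvPolynomial (Fin 2) ℂ)) :
    2 ∣ m * d ∧
      highestWeightSpace (orbitCoordRep (MvPolynomial.rename toLex (perPoly (Fin m) ℂ)) m)
        (partitionWeightLex m (Nat.Partition.rectangle 2 (m * d / 2))) ≠ ⊥ := by
  haveI : NeZero m := ⟨by omega⟩
  have hκ : Function.Injective (fun i : Fin 2 => (toLex ((0 : Fin m), (Fin.castLE hm i)) : MatIdx m)) := by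
    intro i i' h
    have := congrArg (fun z : MatIdx m => (ofLex z).2) h
    simp only [ofLex_toLex] at this
    exact Fin.castLE_injective hm this
  obtain ⟨hdvd, hocc⟩ := hasHighestWeight_rectangle_of_projection (matIdxEquiv m) (show m ≠ 0 by omega)
    (perFormLex_isHomogeneous m) (show 0 < 2 by omega) _ hκ (binaryFermat_isHomogeneous m)
    (binaryFermat_mem_orbitClosure_per hm) hd
  exact ⟨hdvd, hocc⟩

/-- **`(2m, 2m)^* ∈ S(per_m)` for every `m ≥ 2`** (degree `4`): the tableau invariant of BI 2017
Prop. 3.24 has degree `4` and does not vanish at `y^m + w^m` (`4 ≤ binom(2m, m)`).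
[cite: BurgisserIkenmeyer2017, Prop. 3.24 (proof)] -/
theorem per_rectangle_two_twoMul_occurs (hm : 2 ≤ m) :
    highestWeightSpace (orbitCoordRep (MvPolynomial.rename toLex (perPoly (Fin m) ℂ)) m)
      (partitionWeightLex m (Nat.Partition.rectangle 2 (2 * m))) ≠ ⊥ := by
  have h4 : 2 * 2 ≤ Nat.choose (2 * m) m := by
    have h1 : Nat.choose (2 * m) 1 ≤ Nat.choose (2 * m) (2 * m / 2) := Nat.choose_le_middle 1 (2 * m)
    rw [Nat.choose_one_right, show 2 * m / 2 = m by omega] at h1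
    omega
  have hd := two_mul_mem_degreeMonoid_psum (m := 2) (D := m) (by omega) h4
  rw [← binaryFermat_eq_psum] at hd
  obtain ⟨-, hocc⟩ := per_rectangle_two_occurs_of_mem_degreeMonoid hm hd
  rwa [show m * (2 * 2) / 2 = 2 * m by omega] at hocc

/-- **`(m, m)^* ∈ S(per_m)` for even `m ≥ 2`** (degree `2`): `e(y^m + w^m) = 2` (BI 2017
Prop. 3.24 (1)). [cite: BurgisserIkenmeyer2017, Prop. 3.24 (1)] -/
theorem per_rectangle_two_self_occurs_of_even (hm : 2 ≤ m) (heven : Even m) :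
    highestWeightSpace (orbitCoordRep (MvPolynomial.rename toLex (perPoly (Fin m) ℂ)) m)
      (partitionWeightLex m (Nat.Partition.rectangle 2 m)) ≠ ⊥ := by
  have he := (BI2017_prop_3_24_part1 (D := m) (m := 2) hm le_rfl heven).2.1
  rw [← binaryFermat_eq_psum] at he
  obtain ⟨hE, -⟩ := minimalDegree_pos_mem (show 0 < 2 by omega) (binaryFermat_isHomogeneous m)
    (binaryFermat_ne_zero (by omega)) (isPolystable_binaryFermat hm)
  rw [he] at hE
  obtain ⟨-, hocc⟩ := per_rectangle_two_occurs_of_mem_degreeMonoid hm hE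
  rwa [show m * 2 / 2 = m by omega] at hocc

/-- **The first atom on the ray `2` for even `m ≥ 2` is `(m,m)^*`, in degree `2`**: it occurs, no
`(k^2)^*` with `k < m` occurs (first parts `≥ m`), and the least weight on a ray is an atom.
[cite: BurgisserIkenmeyer2017, Prop. 3.24 (1)] -/
theorem per_rayTwo_atom_of_even (hm : 2 ≤ m) (heven : Even m) :
    highestWeightSpace (orbitCoordRep (MvPolynomial.rename toLex (perPoly (Fin m) ℂ)) m)
        (partitionWeightLex m (Nat.Partition.rectangle 2 m)) ≠ ⊥ ∧
      (∀ k : ℕ, 0 < k → k < m →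
        highestWeightSpace (orbitCoordRep (MvPolynomial.rename toLex (perPoly (Fin m) ℂ)) m)
          (partitionWeightLex m (Nat.Partition.rectangle 2 k)) = ⊥) ∧
      (∀ χ₁ χ₂ : Weight (MatIdx m), χ₁ + χ₂ = partitionWeightLex m (Nat.Partition.rectangle 2 m) →
        χ₁ ≠ 0 → χ₂ ≠ 0 →
        highestWeightSpace (orbitCoordRep (MvPolynomial.rename toLex (perPoly (Fin m) ℂ)) m) χ₁ = ⊥ ∨
          highestWeightSpace (orbitCoordRep (MvPolynomial.rename toLex (perPoly (Fin m) ℂ)) m) χ₂ = ⊥) := by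
  have hm1 : 1 ≤ m := by omega
  have h2m : 2 ≤ m * m := by nlinarith
  have hocc := per_rectangle_two_self_occurs_of_even hm heven
  have hmin : ∀ k : ℕ, 0 < k → k < m →
      highestWeightSpace (orbitCoordRep (MvPolynomial.rename toLex (perPoly (Fin m) ℂ)) m)
        (partitionWeightLex m (Nat.Partition.rectangle 2 k)) = ⊥ := by
    intro k hk hkm
    by_contra hne
    have := le_of_per_rectangle_occurs hm1 (by omega) h2m hk hne
    omega
  refine ⟨hocc, hmin, ?_⟩
  obtain ⟨k₀, hk₀, hocc₀, hmin₀, hatom⟩ := exists_least_rectangle_atom _ _ (by omega : 0 < 2) h2m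
    ⟨m, by omega, hocc⟩
  have hk₀m : k₀ = m := by
    rcases lt_trichotomy k₀ m with hlt | heq | hgt
    · exact absurd (hmin k₀ hk₀ hlt) hocc₀
    · exact heq
    · exact absurd (hmin₀ m (by omega) hgt) hocc
  rw [hk₀m] at hatom
  exact hatom

end Summit.ValiantsHypothesis.ValiantsHypothesis.Theorems.GeneratorObstructions.PerGenDegreeSuperQP

end
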